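import Summits.PneNP.PneNP.Theses.KarlinRubin
import Summits.PneNP.PneNP.Theorems.KarlinRubinMonotoneSufficesShiftErrSum
import Summits.PneNP.PneNP.Theorems.KarlinRubinMonotoneSufficesStubDiagonal
import Summits.PneNP.PneNP.Theorems.KarlinRubinMonotoneSufficesStubThresholdSharp
import Literature.Computability.Complexity.CircuitClassesProofs
import Literature.Computability.Complexity.PseudoComplementCircuits
import Literature.Computability.Complexity.RossmanMonotoneCliqueThm2Proofs

/-!
# Crux `MonotoneSuffices` (stmt-PneNP-18026), line `Sketch` — density-shift rung in the crux's format: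
# one whole LAYER of negations of shiftable-or-rare monotone gates is free (`stub_shiftableLayer`),
# and one negation of ANY edge-count threshold is free (`stub_thresholdNegation`)

A detector family with one layer of negation gates is `x ↦ D n (x, ¬g⃗ₙ(x))`, `D n` a
`{∧₂,∨₂,0,1}`-circuit on the edge variables of `Kₙ` plus wires `κ n`, fed with the negations of
monotone gates `g n j`. The rung: if the layer is SHIFTABLE-OR-RARE — for every `ε > 0` there is a
scale `C` such that eventually in `n` some shift size `r ≤ C n` and freeze pattern `b : κ n → Bool` make
the bad event `∃ j, g n j (x ∨ 1_R) = b j` have average (over the `r`-sets `R`) `G(n,1/2)`-probability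
`≤ ε` — then freezing the wires to `b` after hard-wiring the inputs in a good `R` to `1` gives
`{∧₂,∨₂,0,1}`-circuits of size `≤ s n + 2` whose error sum still tends to `0`, at EVERY clique size
`k n` (`stub_shiftableLayer`; the finite estimate is `stub_shiftErrSum`, the scales are `r ≤ C n`,
`u = r + 2(j+1) n`, so the likelihood-ratio price is the constant `e^{8C(C+2(j+1))}` and the tail is
`≤ 1/(4(j+1))`; the `1/(j+1)`-good families are merged by `stub_diagonal`).

Edge-count thresholds `[θ ≤ #supp x]` are shiftable-or-rare uniformly in `θ` (`stub_thresholdSharp`),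
hence `stub_thresholdNegation`: a `{∧₂,∨₂,0,1}`-family of size `≤ s n` reading ONE negated
edge-count threshold gate, with error sum `→ 0`, is simulated by a `{∧₂,∨₂,0,1}`-family of size
`≤ s n + 2` with error sum `→ 0` — the two-sided COIN case (`θ n` in the `√N`-window around `N/2`)
that the second rung `stub_oneNegation` left open, for the sharpest coins of all.
-/

set_option linter.dupNamespace false -- `Summit.PneNP.PneNP.…`: summit = sub-problem name (D-0017)

namespace Summit.PneNP.PneNP.Theorems.MonotoneSuffices.DensityShift

open Literature.Computability.Complexity Literature.Probability.RandomGraphs.PlantedClique Filter Finset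
open scoped ENNReal

/-! ### Freezing a layer after a hard-wired up-shift is a `{∧₂,∨₂,0,1}`-circuit of size `+2` -/

/-- **The frozen, shifted circuit.** For a `{∧₂,∨₂,0,1}`-circuit `D` on inputs `ι ⊕ κ`, a set `R` of
inputs and a freeze pattern `b`, the map `x ↦ D((x ∨ 1_R), b)` is computed by a `{∧₂,∨₂,0,1}`-circuit
with at most two more gates (the two constants). [folklore] -/
theorem layer_freeze_circuit {ι κ : Type*} [DecidableEq ι] (D : Circuit (ι ⊕ κ))
    (hD : D.IsOver monotoneBasis01) (R : Finset ι) (b : κ → Bool) :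
    ∃ M : Circuit ι, M.IsOver monotoneBasis01 ∧ M.size ≤ D.size + 2 ∧
      ∀ x, M.eval x = D.eval (Sum.elim (fun i => x i || decide (i ∈ R)) b) := by
  classical
  -- inputs, the constant `1`, the constant `0`
  have h2 : CktSize monotoneBasis01
      (fun (x : ι → Bool) => Sum.elim (Sum.elim x (fun (_ : Unit) => true)) (fun (_ : Unit) => false))
      (0 + 1 + 1) :=
    ((CktSize.id monotoneBasis01).pair (cktSize_const_mono01 ι true)).pair (cktSize_const_mono01 ι false)
  -- rewire: input `i ∈ R` and wires with `b j = 1` read the constant `1`, wires with `b j = 0` read `0`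
  let ρ : ι ⊕ κ → (ι ⊕ Unit) ⊕ Unit := fun w =>
    match w with
    | Sum.inl i => if i ∈ R then Sum.inl (Sum.inr ()) else Sum.inl (Sum.inl i)
    | Sum.inr j => if b j then Sum.inl (Sum.inr ()) else Sum.inr ()
  have h3 : CktSize monotoneBasis01
      (fun (x : ι → Bool) => Sum.elim (fun i => x i || decide (i ∈ R)) b) (0 + 1 + 1) := by
    refine (h2.outMap ρ).congr fun x w => ?_
    rcases w with i | j
    · by_cases hi : i ∈ R <;> simp [ρ, hi]
    · cases hb : b j <;> simp [ρ, hb]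
  have h4 := h3.comp (D.cktSize_eval hD)
  obtain ⟨M, hM, hsize, hev⟩ := h4.toCircuit
  exact ⟨M, hM, by omega, fun x => hev x⟩

/-! ### Real-arithmetic facts for the scales `r ≤ C n`, `u = r + 2(j+1)n` -/

/-- `C(n,2) ≤ n²/2` and `n² ≤ 4·C(n,2)` for `n ≥ 2` (real form). [folklore] -/
theorem layer_choose_two_bounds {n : ℕ} (hn : 2 ≤ n) :
    ((n.choose 2 : ℕ) : ℝ) ≤ (n : ℝ) ^ 2 / 2 ∧ (n : ℝ) ^ 2 ≤ 4 * ((n.choose 2 : ℕ) : ℝ) := by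
  have h := Nat.choose_two_right n
  have h2 : (n.choose 2 : ℝ) * 2 = (n : ℝ) * ((n : ℝ) - 1) := by
    have h3 : n.choose 2 * 2 = n * (n - 1) := by
      rw [h]; exact Nat.div_mul_cancel (Nat.even_mul_pred_self n).two_dvd
    have h4 : ((n * (n - 1) : ℕ) : ℝ) = (n : ℝ) * ((n : ℝ) - 1) := by
      rw [Nat.cast_mul, Nat.cast_sub (by omega)]; simp
    rw [← h4]; exact_mod_cast h3
  have hn' : (2 : ℝ) ≤ n := by exact_mod_cast hn
  constructor
  · nlinarith
  · nlinarith

/-- **Likelihood-ratio exponent at the rung's scales**: for `r ≤ C n`, `u = r + 2(j+1) n`, `n ≥ 2`,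
`2ur/C(n,2) ≤ 8 C (C + 2(j+1))`. [folklore] -/
theorem layer_exponent_le {n r C j : ℕ} (hn : 2 ≤ n) (hr : r ≤ C * n) :
    2 * ((r + 2 * (j + 1) * n : ℕ) : ℝ) * r / n.choose 2 ≤ 8 * C * (C + 2 * (j + 1)) := by
  obtain ⟨-, hN⟩ := layer_choose_two_bounds hn
  have hNpos : (0 : ℝ) < n.choose 2 := by exact_mod_cast Nat.choose_pos hn
  have hr' : (r : ℝ) ≤ C * n := by exact_mod_cast hr
  have hn0 : (0 : ℝ) ≤ n := Nat.cast_nonneg n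
  rw [div_le_iff₀ hNpos]
  push_cast
  have h1 : 2 * ((r : ℝ) + 2 * ((j : ℝ) + 1) * n) * r ≤ 2 * (C + 2 * ((j : ℝ) + 1)) * C * (n : ℝ) ^ 2 := by
    have hr0 : (0 : ℝ) ≤ r := Nat.cast_nonneg r
    calc 2 * ((r : ℝ) + 2 * ((j : ℝ) + 1) * n) * r ≤ 2 * ((C : ℝ) * n + 2 * ((j : ℝ) + 1) * n) * (C * n) := by
          gcongr
      _ = 2 * (C + 2 * ((j : ℝ) + 1)) * C * (n : ℝ) ^ 2 := by ring
  calc 2 * ((r : ℝ) + 2 * ((j : ℝ) + 1) * n) * r ≤ 2 * (C + 2 * ((j : ℝ) + 1)) * C * (n : ℝ) ^ 2 := h1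
    _ ≤ 2 * (C + 2 * ((j : ℝ) + 1)) * C * (4 * (n.choose 2 : ℝ)) := by gcongr
    _ = 8 * C * (C + 2 * ((j : ℝ) + 1)) * (n.choose 2 : ℝ) := by ring

/-- **Tail at the rung's scales**: for `u = r + 2(j+1)n`, `n ≥ 2`,
`2 C(n,2)/((u - r) + 1)² ≤ 1/(4(j+1))`. [folklore] -/
theorem layer_tail_le {n r j : ℕ} (hn : 2 ≤ n) :
    2 * (n.choose 2 : ℝ) / ((((r + 2 * (j + 1) * n : ℕ) : ℝ)) - r + 1) ^ 2 ≤ 1 / (4 * ((j : ℝ) + 1)) := by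
  obtain ⟨hN, -⟩ := layer_choose_two_bounds hn
  have hn' : (2 : ℝ) ≤ n := by exact_mod_cast hn
  have hj : (0 : ℝ) ≤ j := Nat.cast_nonneg j
  have hrew : ((((r + 2 * (j + 1) * n : ℕ) : ℝ)) - r + 1) = 2 * ((j : ℝ) + 1) * n + 1 := by
    push_cast; ring
  rw [hrew, div_le_div_iff₀ (by positivity) (by positivity)]
  have hn0 : (0 : ℝ) ≤ n := Nat.cast_nonneg n
  calc 2 * (n.choose 2 : ℝ) * (4 * ((j : ℝ) + 1)) ≤ 2 * ((n : ℝ) ^ 2 / 2) * (4 * ((j : ℝ) + 1)) := by gcongr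
    _ = 4 * ((j : ℝ) + 1) * (n : ℝ) ^ 2 := by ring
    _ ≤ 1 * (2 * ((j : ℝ) + 1) * n + 1) ^ 2 := by nlinarith [mul_nonneg hj hn0, sq_nonneg ((j : ℝ) * n)]

/-- `ofReal (1/(j+1)) = (j+1)⁻¹` in `ℝ≥0∞`. [folklore] -/
theorem layer_ofReal_one_div_succ (j : ℕ) :
    ENNReal.ofReal (1 / ((j : ℝ) + 1)) = ((j : ℝ≥0∞) + 1)⁻¹ := by
  rw [one_div, ENNReal.ofReal_inv_of_pos (by positivity), ENNReal.ofReal_add (Nat.cast_nonneg j) zero_le_one,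
    ENNReal.ofReal_natCast, ENNReal.ofReal_one]

/-! ### The layer rung -/

/-- **One good circuit at tolerance `1/(j+1)`** (the finite core of `stub_shiftableLayer`): at a size
`n ≥ 2` where the layer circuit `D` is monotone of size `≤ sz`, the detector `x ↦ D(x, ¬g⃗(x))` has
error sum `≤ e^{-8C(C+2(j+1))}/(4(j+1))`, and some shift size `r ≤ C n ≤ C(n,2)` and freeze pattern
`b` make the bad event `(1/(4(j+1)))`-rare on average, there is a `{∧₂,∨₂,0,1}`-circuit of size
`≤ sz + 2` with error sum `≤ 1/(j+1)` (apply `stub_shiftErrSum` with `u = r + 2(j+1)n` and freeze,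
`layer_freeze_circuit`). [folklore] -/
theorem layer_good_circuit {n kn sz C j : ℕ} {κ : Type*}
    (D : Circuit ((⊤ : SimpleGraph (Fin n)).edgeSet ⊕ κ)) (g : κ → EdgeVec n → Bool)
    (hg : ∀ j, Monotone (g j)) (hDn : D.IsOver monotoneBasis01) (hsz : D.size ≤ sz) (hn : 2 ≤ n)
    (hCn : C * n ≤ n.choose 2)
    (hsm : (erdosRenyiHalf n).toOuterMeasure {x | D.eval (Sum.elim x (fun j => !(g j x))) = true} +
        (plantedCliqueDist n kn).toOuterMeasure {x | D.eval (Sum.elim x (fun j => !(g j x))) = false} ≤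
      ENNReal.ofReal (Real.exp (-(8 * C * (C + 2 * (j + 1)))) * (1 / (4 * ((j : ℝ) + 1)))))
    (hshift : ∃ r : ℕ, r ≤ C * n ∧ ∃ b : κ → Bool,
      (∑ R ∈ (univ : Finset ((⊤ : SimpleGraph (Fin n)).edgeSet)).powersetCard r,
          (erdosRenyiHalf n).toOuterMeasure {x | ∃ j, g j (fun e => x e || decide (e ∈ R)) = b j}) ≤
        ENNReal.ofReal (1 / (4 * ((j : ℝ) + 1))) * ((n.choose 2).choose r : ℝ≥0∞)) :
    ∃ M : Circuit ((⊤ : SimpleGraph (Fin n)).edgeSet), M.IsOver monotoneBasis01 ∧ M.size ≤ sz + 2 ∧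
      (erdosRenyiHalf n).toOuterMeasure {x | M.eval x = true} +
          (plantedCliqueDist n kn).toOuterMeasure {x | M.eval x = false} ≤ ((j : ℝ≥0∞) + 1)⁻¹ := by
  classical
  obtain ⟨r, hr, b, hb⟩ := hshift
  set ε : ℝ := 1 / (4 * ((j : ℝ) + 1)) with hε
  have hε0 : 0 ≤ ε := by positivity
  have hN : 0 < n.choose 2 := Nat.choose_pos hn
  have hrN : r ≤ n.choose 2 := hr.trans hCn
  set u : ℕ := r + 2 * (j + 1) * n with hu
  have hru : r ≤ u := Nat.le_add_right _ _
  -- `F x w = D (x, w)` is monotone in the wires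
  have hmono : Monotone D.eval := D.monotone_eval_of_isOver_monotoneBasis01 hDn
  have hF : ∀ x : EdgeVec n, Monotone (fun w : κ → Bool => D.eval (Sum.elim x w)) := by
    intro x w w' hww'
    refine hmono fun v => ?_
    cases v with
    | inl i => exact le_rfl
    | inr jj => exact hww' jj
  obtain ⟨R, -, hR⟩ := stub_shiftErrSum n kn r u (fun x w => D.eval (Sum.elim x w)) g b hF hg hru hrN hN
  obtain ⟨M, hM, hMsize, hMev⟩ := layer_freeze_circuit D hDn R b
  refine ⟨M, hM, by omega, ?_⟩
  simp only [hMev]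
  refine hR.trans ?_
  -- the three terms
  have hC0 : ((n.choose 2).choose r : ℝ≥0∞) ≠ 0 := Nat.cast_ne_zero.2 (Nat.choose_pos hrN).ne'
  have hCtop : ((n.choose 2).choose r : ℝ≥0∞) ≠ ⊤ := ENNReal.natCast_ne_top _
  have h1 : ENNReal.ofReal (Real.exp (2 * (u : ℝ) * r / n.choose 2)) *
      ((erdosRenyiHalf n).toOuterMeasure {x | D.eval (Sum.elim x (fun j => !(g j x))) = true} +
        (plantedCliqueDist n kn).toOuterMeasure {x | D.eval (Sum.elim x (fun j => !(g j x))) = false}) ≤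
      ENNReal.ofReal ε := by
    have hexp : Real.exp (2 * (u : ℝ) * r / n.choose 2) ≤ Real.exp (8 * C * (C + 2 * (j + 1))) :=
      Real.exp_le_exp.2 (by simpa [hu] using layer_exponent_le (j := j) hn hr)
    calc _ ≤ ENNReal.ofReal (Real.exp (8 * C * (C + 2 * (j + 1)))) *
          ENNReal.ofReal (Real.exp (-(8 * C * (C + 2 * (j + 1)))) * ε) :=
          mul_le_mul' (ENNReal.ofReal_le_ofReal hexp) hsm
      _ = ENNReal.ofReal ε := by
          rw [← ENNReal.ofReal_mul (Real.exp_nonneg _), ← mul_assoc, ← Real.exp_add, add_neg_cancel,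
            Real.exp_zero, one_mul]
  have h2 : ENNReal.ofReal (2 * (n.choose 2 : ℝ) / ((u : ℝ) - r + 1) ^ 2) ≤ ENNReal.ofReal ε :=
    ENNReal.ofReal_le_ofReal (by rw [hε]; simpa [hu] using layer_tail_le (r := r) (j := j) hn)
  have h3 : 2 * (∑ R' ∈ (univ : Finset ((⊤ : SimpleGraph (Fin n)).edgeSet)).powersetCard r,
      (erdosRenyiHalf n).toOuterMeasure {x | ∃ j, g j (fun e => x e || decide (e ∈ R')) = b j}) /
        ((n.choose 2).choose r : ℝ≥0∞) ≤ 2 * ENNReal.ofReal ε := by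
    calc _ ≤ 2 * (ENNReal.ofReal ε * ((n.choose 2).choose r : ℝ≥0∞)) / ((n.choose 2).choose r : ℝ≥0∞) := by
          gcongr
      _ = 2 * ENNReal.ofReal ε := by
          rw [← mul_assoc, ENNReal.mul_div_cancel_right hC0 hCtop]
  calc _ ≤ ENNReal.ofReal ε + ENNReal.ofReal ε + 2 * ENNReal.ofReal ε := add_le_add (add_le_add h1 h2) h3
    _ = ENNReal.ofReal (4 * ε) := by
        rw [ENNReal.ofReal_mul (by norm_num : (0 : ℝ) ≤ 4), ENNReal.ofReal_ofNat]
        ring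
    _ = ((j : ℝ≥0∞) + 1)⁻¹ := by
        rw [← layer_ofReal_one_div_succ, hε]
        congr 1
        field_simp

/-- **`stub_shiftableLayer`** (registered stub of stmt-PneNP-18026, line `Sketch`, density-shift rung,
crux format): **one whole layer of negations of SHIFTABLE-OR-RARE monotone gates is free.** Let
`{∧₂,∨₂,0,1}`-circuits `D n` of size `≤ s n` read the edge variables of `Kₙ` and wires fed with
`¬(g n j)(x)`, all `g n j` monotone, and strongly detect the planted `k n`-clique (error sum `→ 0`).
Suppose the layer is shiftable-or-rare: for every `ε > 0` there is `C` such that eventually some shift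
size `r ≤ C n` and freeze pattern `b` make the average over `r`-sets `R` of
`Pr₀[∃ j, g n j (x ∨ 1_R) = b j]` at most `ε`. Then some `{∧₂,∨₂,0,1}`-family of size `≤ s n + 2`
strongly detects too (`layer_good_circuit` at every tolerance, merged by `stub_diagonal`). No condition on
`k`. [folklore] -/
theorem stub_shiftableLayer :
    ∀ (k s : ℕ → ℕ) (κ : ℕ → Type)
      (D : (n : ℕ) → Circuit ((⊤ : SimpleGraph (Fin n)).edgeSet ⊕ κ n))
      (g : (n : ℕ) → κ n → EdgeVec n → Bool),
      (∀ n j, Monotone (g n j)) →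
      (∀ᶠ n : ℕ in atTop, (D n).IsOver monotoneBasis01 ∧ (D n).size ≤ s n) →
      Tendsto (fun n : ℕ =>
          (erdosRenyiHalf n).toOuterMeasure {x | (D n).eval (Sum.elim x (fun j => !(g n j x))) = true} +
            (plantedCliqueDist n (k n)).toOuterMeasure
              {x | (D n).eval (Sum.elim x (fun j => !(g n j x))) = false}) atTop (nhds 0) →
      (∀ ε : ℝ, 0 < ε → ∃ C : ℕ, ∀ᶠ n : ℕ in atTop, ∃ r : ℕ, r ≤ C * n ∧ ∃ b : κ n → Bool,
          (∑ R ∈ (univ : Finset ((⊤ : SimpleGraph (Fin n)).edgeSet)).powersetCard r,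
              (erdosRenyiHalf n).toOuterMeasure
                {x | ∃ j, g n j (fun e => x e || decide (e ∈ R)) = b j}) ≤
            ENNReal.ofReal ε * ((n.choose 2).choose r : ℝ≥0∞)) →
      ∃ M : (n : ℕ) → Circuit ((⊤ : SimpleGraph (Fin n)).edgeSet),
        (∀ᶠ n : ℕ in atTop, (M n).IsOver monotoneBasis01 ∧ (M n).size ≤ s n + 2) ∧
        Tendsto (fun n : ℕ => (erdosRenyiHalf n).toOuterMeasure {x | (M n).eval x = true} +
            (plantedCliqueDist n (k n)).toOuterMeasure {x | (M n).eval x = false}) atTop (nhds 0) := by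
  intro k s κ D g hg hD herr hshift
  classical
  refine stub_diagonal (X := fun n => Circuit ((⊤ : SimpleGraph (Fin n)).edgeSet))
    (fun n M => M.IsOver monotoneBasis01 ∧ M.size ≤ s n + 2)
    (fun n M => (erdosRenyiHalf n).toOuterMeasure {x | M.eval x = true} +
      (plantedCliqueDist n (k n)).toOuterMeasure {x | M.eval x = false}) fun j => ?_
  -- tolerance `1/(4(j+1))`, scale `C`, threshold `η`
  have hεpos : (0 : ℝ) < 1 / (4 * ((j : ℝ) + 1)) := by positivity
  obtain ⟨C, hC⟩ := hshift _ hεpos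
  have hηpos : (0 : ℝ) < Real.exp (-(8 * C * (C + 2 * (j + 1)))) * (1 / (4 * ((j : ℝ) + 1))) := by positivity
  have hsmall := ENNReal.tendsto_nhds_zero.1 herr _ (ENNReal.ofReal_pos.2 hηpos)
  have harith : ∀ᶠ n : ℕ in atTop, 2 ≤ n ∧ C * n ≤ n.choose 2 := by
    filter_upwards [eventually_ge_atTop (2 * C + 2)] with n hn
    refine ⟨by omega, ?_⟩
    rw [Nat.choose_two_right, Nat.le_div_iff_mul_le two_pos]
    calc C * n * 2 = n * (2 * C) := by ring
      _ ≤ n * (n - 1) := Nat.mul_le_mul_left n (by omega)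
  -- the good sizes
  let Good : ℕ → Prop := fun n => ((D n).IsOver monotoneBasis01 ∧ (D n).size ≤ s n) ∧
    (2 ≤ n ∧ C * n ≤ n.choose 2) ∧
    ((erdosRenyiHalf n).toOuterMeasure {x | (D n).eval (Sum.elim x (fun j => !(g n j x))) = true} +
        (plantedCliqueDist n (k n)).toOuterMeasure {x | (D n).eval (Sum.elim x (fun j => !(g n j x))) = false} ≤
      ENNReal.ofReal (Real.exp (-(8 * C * (C + 2 * (j + 1)))) * (1 / (4 * ((j : ℝ) + 1))))) ∧
    (∃ r : ℕ, r ≤ C * n ∧ ∃ b : κ n → Bool,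
      (∑ R ∈ (univ : Finset ((⊤ : SimpleGraph (Fin n)).edgeSet)).powersetCard r,
          (erdosRenyiHalf n).toOuterMeasure {x | ∃ j, g n j (fun e => x e || decide (e ∈ R)) = b j}) ≤
        ENNReal.ofReal (1 / (4 * ((j : ℝ) + 1))) * ((n.choose 2).choose r : ℝ≥0∞))
  have hgood : ∀ᶠ n : ℕ in atTop, Good n := hD.and (harith.and (hsmall.and hC))
  have hex : ∀ n, Good n → ∃ M : Circuit ((⊤ : SimpleGraph (Fin n)).edgeSet),
      M.IsOver monotoneBasis01 ∧ M.size ≤ s n + 2 ∧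
        (erdosRenyiHalf n).toOuterMeasure {x | M.eval x = true} +
          (plantedCliqueDist n (k n)).toOuterMeasure {x | M.eval x = false} ≤ ((j : ℝ≥0∞) + 1)⁻¹ :=
    fun n hG => layer_good_circuit (D n) (g n) (hg n) hG.1.1 hG.1.2 hG.2.1.1 hG.2.1.2 hG.2.2.1 hG.2.2.2
  refine ⟨fun n => if h : Good n then (hex n h).choose else Circuit.const _ false, ?_⟩
  filter_upwards [hgood] with n hn
  rw [dif_pos hn]
  obtain ⟨h1, h2, h3⟩ := (hex n hn).choose_spec
  exact ⟨⟨h1, h2⟩, h3⟩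

/-! ### One negation of an edge-count threshold is free -/

/-- Edge-count threshold gates `[θ ≤ #supp x]` are monotone. [folklore] -/
theorem layer_threshold_monotone (n θ : ℕ) :
    Monotone (fun x : EdgeVec n => decide (θ ≤ #(univ.filter fun e => x e = true))) := by
  intro x y hxy
  have hsub : (univ.filter fun e => x e = true) ⊆ (univ.filter fun e => y e = true) := fun e he => by
    simp only [mem_filter, mem_univ, true_and] at he ⊢
    have h := hxy e
    rw [he] at h
    exact Bool.eq_true_of_true_le h
  have hcard := card_le_card hsub
  show decide _ ≤ decide _
  by_cases h : θ ≤ #(univ.filter fun e => x e = true)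
  · rw [decide_eq_true h, decide_eq_true (h.trans hcard)]
  · rw [decide_eq_false h]; exact Bool.false_le _

/-- **`stub_thresholdNegation`** (density-shift rung of stmt-PneNP-18026, line `Sketch`, crux format):
**one negation of ANY edge-count threshold gate is free on the planted pair.** If `{∧₂,∨₂,0,1}`-circuits
`D n` of size `≤ s n`, reading the edge variables of `Kₙ` and ONE wire carrying `¬[θ n ≤ #edges(x)]`,
strongly detect the planted `k n`-clique, then some `{∧₂,∨₂,0,1}`-family of size `≤ s n + 2` does —
for every threshold sequence `θ` and every `k` (`stub_shiftableLayer` + `stub_thresholdSharp`: thresholds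
below `N/2 + C'n` are forced by a `4C'n`-up-shift, the others are null-rare). This is the coin case of
the second rung (`stub_oneNegation`) for the sharpest two-sided coins, the edge-count majorities.
[folklore] -/
theorem stub_thresholdNegation :
    ∀ (k s θ : ℕ → ℕ) (D : (n : ℕ) → Circuit ((⊤ : SimpleGraph (Fin n)).edgeSet ⊕ Unit)),
      (∀ᶠ n : ℕ in atTop, (D n).IsOver monotoneBasis01 ∧ (D n).size ≤ s n) →
      Tendsto (fun n : ℕ =>
          (erdosRenyiHalf n).toOuterMeasure {x | (D n).eval
              (Sum.elim x (fun _ => !decide (θ n ≤ #(univ.filter fun e => x e = true)))) = true} +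
            (plantedCliqueDist n (k n)).toOuterMeasure {x | (D n).eval
              (Sum.elim x (fun _ => !decide (θ n ≤ #(univ.filter fun e => x e = true)))) = false})
        atTop (nhds 0) →
      ∃ M : (n : ℕ) → Circuit ((⊤ : SimpleGraph (Fin n)).edgeSet),
        (∀ᶠ n : ℕ in atTop, (M n).IsOver monotoneBasis01 ∧ (M n).size ≤ s n + 2) ∧
        Tendsto (fun n : ℕ => (erdosRenyiHalf n).toOuterMeasure {x | (M n).eval x = true} +
            (plantedCliqueDist n (k n)).toOuterMeasure {x | (M n).eval x = false}) atTop (nhds 0) := by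
  intro k s θ D hD herr
  classical
  refine stub_shiftableLayer k s (fun _ => Unit) D
    (fun n _ x => decide (θ n ≤ #(univ.filter fun e => x e = true))) (fun n _ => layer_threshold_monotone n (θ n))
    hD herr fun ε hε => ?_
  obtain ⟨C, hC⟩ := stub_thresholdSharp ε hε
  refine ⟨C, ?_⟩
  filter_upwards [hC] with n hn
  rcases hn (θ n) with hA | hB
  · -- forced by the `C n`-shift: freeze the wire `¬g` to `0`
    refine ⟨C * n, le_rfl, fun _ => false, ?_⟩
    have hcardE : Fintype.card ((⊤ : SimpleGraph (Fin n)).edgeSet) = n.choose 2 := card_edgeSet_top_fin n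
    calc ∑ R ∈ (univ : Finset ((⊤ : SimpleGraph (Fin n)).edgeSet)).powersetCard (C * n),
          (erdosRenyiHalf n).toOuterMeasure {x | ∃ _ : Unit,
            decide (θ n ≤ #(univ.filter fun e => (x e || decide (e ∈ R)) = true)) = false}
        ≤ ∑ _R ∈ (univ : Finset ((⊤ : SimpleGraph (Fin n)).edgeSet)).powersetCard (C * n), ENNReal.ofReal ε := by
          refine sum_le_sum fun R hR => ?_
          have hset : {x : EdgeVec n | ∃ _ : Unit,
              decide (θ n ≤ #(univ.filter fun e => (x e || decide (e ∈ R)) = true)) = false} =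
              {x | #(univ.filter fun e => (x e || decide (e ∈ R)) = true) < θ n} := Set.ext fun x => by
            simp only [Set.mem_setOf_eq, exists_const, decide_eq_false_iff_not, not_le]
          rw [hset]
          exact hA R hR
      _ = ENNReal.ofReal ε * ((n.choose 2).choose (C * n) : ℝ≥0∞) := by
          rw [sum_const, nsmul_eq_mul, card_powersetCard, card_univ, hcardE, mul_comm]
  · -- null-rare: no shift, freeze the wire `¬g` to `1`
    refine ⟨0, Nat.zero_le _, fun _ => true, ?_⟩
    rw [powersetCard_zero, sum_singleton, Nat.choose_zero_right, Nat.cast_one, mul_one]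
    have hset : {x : EdgeVec n | ∃ _ : Unit,
        decide (θ n ≤ #(univ.filter fun e => (x e || decide (e ∈ (∅ : Finset _))) = true)) = true} =
        {x | θ n ≤ #(univ.filter fun e => x e = true)} := Set.ext fun x => by
      simp only [Set.mem_setOf_eq, exists_const, decide_eq_true_eq, Finset.notMem_empty, decide_false,
        Bool.or_false]
    rw [hset]
    exact hB

end Summit.PneNP.PneNP.Theorems.MonotoneSuffices.DensityShift
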